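import Literature.NumberTheory.Automorphic.UpqGlobalizationTorusLawU21
import Literature.NumberTheory.Automorphic.UpqUnitaryGlobalization
import Literature.NumberTheory.Automorphic.UpqLieCartanSpan
import Literature.NumberTheory.Automorphic.InfUnitaryFactorialBoundOfIrrep
import Literature.NumberTheory.Automorphic.UnitaryGroupArchCharacter
import HarnessLib

/-!
# The unitary globalization of an irreducible admissible infinitesimally unitary `(𝔤, K)`-module of `U(2,1)`
# (letter A6 `HasUnitaryGlobalizationOfInfUnitary` [KnappVogan1995, Thm. 0.6 (a)] AT `(α, β) = (Fin 2, Fin 1)` — the HEAD of ROAD-A6)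

Topic `NumberTheory/Automorphic`.  THEOREMS ONLY (one theorem); no definition, no instance, no notation, no named fact, no `sorry`.
Cell `hodgecm-mathlib`, F0∕P3, in-house road «rank-one torus analytic continuation + weak `Ad`-identity + `KAK`» to the letter A6 #92 at `U(2,1)`
(ROAD-GLOB v1.1; LEAD F0P3b-p01 (g3); bricks by A-p14 (g24), A-p06 (g24), A-p03 (g22), A-p01 (g18), B-p17 (g22)).

THE STATEMENT (`hasUnitaryGlobalization_of_isInfUnitary_uTwoOne`).  Every irreducible admissible `(𝔤, K)`-module `r` of `G = U(2,1)` which is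
infinitesimally unitary (★ `Liu2021.LemD2.IsInfUnitary`: an invariant positive definite Hermitian form, `K` unitary, `𝔤` skew) has a unitary
globalization (★ `HasUnitaryGlobalization`: a unitary strongly continuous representation of `G` on a Hilbert space whose `(𝔤, K)`-module of
`K`-finite vectors is `r`).

THE PROOF (pure assembly of ★ bricks).  `B := InfUnitary.form hu` is positive definite Hermitian (★ G0 §6), `K`-invariant and `𝔤`-skew; the
factorial bounds (FB) ★ `InfUnitary.factorialBound` (Casimir scalar + a generating `K`-type) hold at some `K₀ ≥ 0`, bumped here to `K₀ + 1 > 0`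
(`C ↦ |C|`, monotonicity); on the completion `hB.E` the unitary `K`-action `hB.kRep` and the unitary one-parameter group `U₀ = hB.U ρ (K₀+1) H₀`
of the boost generator `H₀ = upqUnit (0,0) (−i)` satisfy `U₀(0) = 1`, the `M`-commutation and the Weyl relation (★ Φ3-a); the `KAK`-descended
operator family `Φ = globOp 0 0 ϖK U₀` obeys the torus translation law `Φ(g a_s) = Φ(g) ∘ U₀(s)` on `U(2,1)` (★ `globOp_mul_hypV_uTwoOne`:
Φ2-core ∘ Φ2-diff ∘ Φ2-geom), hence is a unitary strongly continuous representation `globRep` whose differential on `ι V` along `𝔨 ∪ 𝔭` is `ρ`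
(★ Φ3 `isUnitaryGlobalization_globRep` over ★ H `isUnitaryGlobalization_of_recognition`, with `span (𝔨 ∪ 𝔭) = 𝔤` ★ Φ3-b).
[KnappVogan1995, Introduction Thm. 0.6 (a)]; [HarishChandra1953, §11 Thms. 8–9]; [Knapp2002, VII §3 Thm. 7.39].

HONEST LABEL: this is the letter A6 ONLY at `(2,1)` (rank one, `|β| = 1`, where `KAK` has a one-dimensional `A`); the general `U(α,β)` letter
★ `HasUnitaryGlobalizationOfInfUnitary` (all signatures) is NOT proved here.

ED. 2 (docstring-only, 2026-08-31, director s733 ∕ REF F0P3b-ref2 (g2) T1a verdict): the Harish-Chandra locator is §11 (Thms. 8–9), not §9;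
no statement or proof byte changed.

## Mathlib ∕ tree search
Mathlib has no `(𝔤, K)`-modules and no globalization theorem.  Tree: `rg "hasUnitaryGlobalization_of_isInfUnitary" Literature/` — no hits (new);
consumers: T1a line `Cruxes/H413/Lines/F0_T1a_ArchCharactersLinIndep.lean` `stub_globExists` (ED. 10 re-types it to this (2,1) text) via
★ `F0T1aArchRealCaseU21` (A-p06 (g24)).

## References
* A. W. Knapp, D. A. Vogan, *Cohomological Induction and Unitary Representations* (1995), Introduction, Thm. 0.6 (a) [KnappVogan1995].
* Harish-Chandra, *Representations of a semisimple Lie group on a Banach space. I*, Trans. AMS 75 (1953), §11 (Thms. 8–9) [HarishChandra1953].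
* A. W. Knapp, *Lie Groups Beyond an Introduction*, 2nd ed. (2002), VII §3 Thm. 7.39 [Knapp2002].
-/

set_option autoImplicit false

noncomputable section

open Complex
open scoped InnerProductSpace Nat Matrix.Norms.Operator MatrixGroups Topology

namespace Literature.NumberTheory.Automorphic

open Literature.RepresentationTheory Literature.RepresentationTheory.KonnoKonno2007 Literature.RepresentationTheory.KonnoKonno2007.RealDualPair
open Literature.RepresentationTheory.KonnoKonno2007.RealDualPair.UForm Literature.RepresentationTheory.BorelWallach2000

/-- The factorial bounds (FB) at a constant `K₀ ≥ 0` also hold at `K₀ + 1 > 0` (replace `C` by `|C|`; monotonicity of `K ↦ K ^ m`).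
[cite: HarishChandra1953, §11] -/
theorem InfUnitary.factorialBound_pos (r : GKIrrep (uFormGroup (Fin 2) (Fin 1))) (hu : Liu2021.LemD2.IsInfUnitary r.ρK r.ρ𝔤) :
    ∃ K : ℝ, 0 < K ∧ ∀ v : r.V, ∃ C : ℝ, ∀ (m : ℕ) (X : Fin m → (uFormGroup (Fin 2) (Fin 1)).lie),
      ‖(InfUnitary.isPosDefHerm_form hu).emb ((List.ofFn fun i => (r.ρ𝔤 (X i) : r.V →ₗ[ℂ] r.V)).prod v)‖ ≤
        C * m ! * K ^ m * ∏ i, ‖((X i : (uFormGroup (Fin 2) (Fin 1)).lie) : Matrix (Fin 2 ⊕ Fin 1) (Fin 2 ⊕ Fin 1) ℂ)‖ := by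
  obtain ⟨K₀, hK₀, hFB₀⟩ := InfUnitary.factorialBound r hu
  refine ⟨K₀ + 1, by linarith, fun v => ?_⟩
  obtain ⟨C, hC⟩ := hFB₀ v
  refine ⟨|C|, fun m X => (hC m X).trans ?_⟩
  have hP : 0 ≤ ∏ i, ‖((X i : (uFormGroup (Fin 2) (Fin 1)).lie) : Matrix (Fin 2 ⊕ Fin 1) (Fin 2 ⊕ Fin 1) ℂ)‖ :=
    Finset.prod_nonneg fun i _ => norm_nonneg _
  calc C * (m.factorial : ℝ) * K₀ ^ m * ∏ i, ‖((X i : (uFormGroup (Fin 2) (Fin 1)).lie) : Matrix (Fin 2 ⊕ Fin 1) (Fin 2 ⊕ Fin 1) ℂ)‖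
      ≤ |C| * (m.factorial : ℝ) * K₀ ^ m * ∏ i, ‖((X i : (uFormGroup (Fin 2) (Fin 1)).lie) : Matrix (Fin 2 ⊕ Fin 1) (Fin 2 ⊕ Fin 1) ℂ)‖ :=
        mul_le_mul_of_nonneg_right (mul_le_mul_of_nonneg_right (mul_le_mul_of_nonneg_right (le_abs_self C) (by positivity))
          (pow_nonneg hK₀ m)) hP
    _ ≤ |C| * (m.factorial : ℝ) * (K₀ + 1) ^ m * ∏ i, ‖((X i : (uFormGroup (Fin 2) (Fin 1)).lie) : Matrix (Fin 2 ⊕ Fin 1) (Fin 2 ⊕ Fin 1) ℂ)‖ := by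
        gcongr
        linarith

/-- **LETTER A6 AT `U(2,1)` — THE UNITARY GLOBALIZATION OF AN IRREDUCIBLE ADMISSIBLE INFINITESIMALLY UNITARY `(𝔤, K)`-MODULE OF `U(2,1)`.**
Assembly: `B := InfUnitary.form hu` (★ G0), (FB) at `K₀ + 1 > 0` (`InfUnitary.factorialBound_pos`), `U₀(0) = 1` ∕ `M`-commutation ∕ Weyl relation
(★ Φ3-a), the torus law on `U(2,1)` (★ `globOp_mul_hypV_uTwoOne`), `span (𝔨 ∪ 𝔭) = 𝔤` (★ Φ3-b), and ★ `isUnitaryGlobalization_globRep` (Φ3 over ★ H).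
[cite: KnappVogan1995, Introduction Thm. 0.6 (a)] [cite: HarishChandra1953, §11] [cite: Knapp2002, VII §3 Thm. 7.39] -/
theorem hasUnitaryGlobalization_of_isInfUnitary_uTwoOne (r : GKIrrep (uFormGroup (Fin 2) (Fin 1))) (hadm : IsAdmissibleGK r.ρK)
    (hu : Liu2021.LemD2.IsInfUnitary r.ρK r.ρ𝔤) : HasUnitaryGlobalization (uFormGroup (Fin 2) (Fin 1)) (GKIrrClass.mk r) := by
  have hB := InfUnitary.isPosDefHerm_form hu
  obtain ⟨K, hK, hFB⟩ := InfUnitary.factorialBound_pos r hu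
  have hskew : ∀ (X : (uFormGroup (Fin 2) (Fin 1)).lie) (x y : r.V), InfUnitary.form hu (r.ρ𝔤 X x) y = -InfUnitary.form hu x (r.ρ𝔤 X y) :=
    InfUnitary.form_skew hu
  have hinv : ∀ (k : (uFormGroup (Fin 2) (Fin 1)).maximalCompact) (x y : r.V),
      InfUnitary.form hu (r.ρK k x) (r.ρK k y) = InfUnitary.form hu x y :=
    InfUnitary.form_inv hu
  have hU0 := hB.U_boostUnit_zero (0 : Fin 2) (0 : Fin 1) hK hskew hFB
  have hM := hB.kRep_comp_U_boostUnit_of_commute (0 : Fin 2) (0 : Fin 1) r.isGKModule hinv hK hskew hFB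
  have hW := hB.kRep_weyl_comp_U_boostUnit (0 : Fin 2) (0 : Fin 1) r.isGKModule hinv hK hskew hFB
  have htorus : ∀ (g : UForm (Fin 2) (Fin 1)) (s : ℝ),
      globOp (0 : Fin 2) (0 : Fin 1) (hB.kRep r.ρK hinv) (hB.U r.ρ𝔤 K (upqUnit ((0 : Fin 2), (0 : Fin 1)) (-I))) (g * hypV (0 : Fin 2) (0 : Fin 1) s) =
        globOp (0 : Fin 2) (0 : Fin 1) (hB.kRep r.ρK hinv) (hB.U r.ρ𝔤 K (upqUnit ((0 : Fin 2), (0 : Fin 1)) (-I))) g ∘L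
          hB.U r.ρ𝔤 K (upqUnit ((0 : Fin 2), (0 : Fin 1)) (-I)) s :=
    fun g s => hB.globOp_mul_hypV_uTwoOne r.isGKModule hinv hK hskew hFB g s
  exact hasUnitaryGlobalization_of_isUnitaryGlobalization _
    (hB.isUnitaryGlobalization_globRep (0 : Fin 2) (0 : Fin 1) r hadm hK hskew hFB hU0 hM hW htorus upq_span_compactLie_union_herm_eq_top)

end Literature.NumberTheory.Automorphic

end
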